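import Summits.QuantumAdvantage.QuantumAdvantage.Theorems.RandomOracleGaugeDecoupledCoreAAL1FamilyExpRung
import Literature.Computability.QuantumComplexity.InfluenceBounds
import HarnessLib

/-!
# Crux `DecoupledCoreAA` (stmt-QuantumAdvantage-17872), line `l1-family`, stub `stub_l1Family` —
# for GRADIENT families alternative (B) is dominated by alternative (A): `(B)_j ≤ 4d · (A)_j`

The families produced by O'Donnell–Zhao's one-block decoupling are GRADIENT families: `g_i = (f − f∘flip_i)/(2L)` for a
single polynomial `f` (of degree `≤ d`) and a normalisation `L`.  For such a family the coordinate alternative of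
`stub_l1Family` is never the only way out: since bit flips commute, `g_i − g_i∘flip_j = (g_j − g_j∘flip_i)`-type symmetry
gives `Σ_i E[(g_i − g_i^{⊕j})²] = Σ_i Inf_i[g_j] ≤ 4d · E[g_j²]` — the aggregate influence of coordinate `j` is at most
`4d` times the mass of MEMBER `j`.  Hence on full gradient families the dichotomy (A) ∨ (B) at scale `θ` implies (A) alone
at scale `θ/(4d)`, i.e. it is literally "`f` has an influential variable": the extra generality of the stub (arbitrary
ℓ¹-families, SUB-families of gradients such as the table half of the address function's gradient) is exactly where (B)
becomes indispensable (`…L1FamilyAddress.not_l1Family_memberOnly`).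

* `sum_influence_le_degree_mul` — `Σ_i Inf_i[h] ≤ 4d·E[h²]` for `h` of degree `≤ d` (Walsh: `4Σ|S|ĥ(S)² ≤ 4dΣĥ(S)²`);
* `flipBit_comm`, `gradient_coordinate_eq_member` (`Σ_i E[(g_i − g_i^{⊕j})²] = Σ_i Inf_i[g_j]` for gradient families),
  `gradient_coordinate_le_member` (`(B)_j ≤ 4d·(A)_j`), `gradientFamily_memberOnly_of_dichotomy`.

Honest label: structural remark in kernel; no stub, crux or summit is closed.  Sources: O'Donnell–Zhao arXiv:1512.01603
Def. 1.1, eqn. (2.1); O'Donnell 2014 §2.2–2.3.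
-/

-- D-0017: single-conjunct summit ⇒ the duplicate `QuantumAdvantage.QuantumAdvantage` is mandated.
set_option linter.dupNamespace false

noncomputable section

open Finset
open Literature.Computability.QuantumComplexity
open Literature.Computability.Complexity.LowDegree (cubeFourierCoeff sum_cubeFourierCoeff_sq)

namespace Summit.QuantumAdvantage.QuantumAdvantage.Cruxes.DecoupledCoreAA.L1Family.Gradient

variable {N : ℕ}

/-- **`Σ_i Inf_i[h] ≤ 4d · E[h²]`** for a polynomial `h` of total degree `≤ d` (total influence `4Σ_S |S| ĥ(S)²` against
Parseval `Σ_S ĥ(S)² = E[h²]`, with `ĥ(S) = 0` for `|S| > d`). [cite: ODonnell2014, §2.3] -/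
theorem sum_influence_le_degree_mul {d : ℕ} (h : MvPolynomial (Fin N) ℝ) (hdeg : h.totalDegree ≤ d) :
    ∑ i, influence i h ≤ 4 * (d : ℝ) * boolAvg (fun z => evalBool h z ^ 2) := by
  classical
  have hpar : boolAvg (fun z => evalBool h z ^ 2) = ∑ S, cubeFourierCoeff (evalBool h) S ^ 2 := by
    rw [sum_cubeFourierCoeff_sq]; rfl
  have hterm : ∀ S : Finset (Fin N), (S.card : ℝ) * cubeFourierCoeff (evalBool h) S ^ 2 ≤
      (d : ℝ) * cubeFourierCoeff (evalBool h) S ^ 2 := by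
    intro S
    by_cases hS : d < S.card
    · rw [cubeFourierCoeff_evalBool_eq_zero hdeg hS]; simp
    · exact mul_le_mul_of_nonneg_right (by exact_mod_cast not_lt.mp hS) (sq_nonneg _)
  calc ∑ i, influence i h = 4 * ∑ S, (S.card : ℝ) * cubeFourierCoeff (evalBool h) S ^ 2 := sum_influence_eq h
    _ ≤ 4 * ∑ S, (d : ℝ) * cubeFourierCoeff (evalBool h) S ^ 2 :=
        mul_le_mul_of_nonneg_left (Finset.sum_le_sum fun S _ => hterm S) (by norm_num)
    _ = 4 * (d : ℝ) * ∑ S, cubeFourierCoeff (evalBool h) S ^ 2 := by rw [← Finset.mul_sum]; ring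
    _ = 4 * (d : ℝ) * boolAvg (fun z => evalBool h z ^ 2) := by rw [hpar]

/-- Bit flips at different (or equal) coordinates commute. [folklore] -/
theorem flipBit_comm (i j : Fin N) (z : Fin N → Bool) : flipBit i (flipBit j z) = flipBit j (flipBit i z) := by
  funext k
  unfold flipBit
  by_cases hki : k = i
  · subst hki
    by_cases hkj : k = j
    · subst hkj; simp
    · simp [Function.update_self, Function.update_of_ne hkj, Function.update_of_ne (Ne.symm hkj)]
  · by_cases hkj : k = j
    · subst hkj
      simp [Function.update_self, Function.update_of_ne hki]
    · simp [Function.update_of_ne hki, Function.update_of_ne hkj]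

/-- For the discrete gradient of `f`, the `j`-difference of member `i` is the `i`-difference of member `j`:
`(f − f∘flip_i) − (f − f∘flip_i)∘flip_j = (f − f∘flip_j) − (f − f∘flip_j)∘flip_i` pointwise. [cite: ODonnellZhao2016, Def. 1.1] -/
theorem gradient_swap (f : MvPolynomial (Fin N) ℝ) (i j : Fin N) (z : Fin N → Bool) :
    (evalBool f z - evalBool f (flipBit i z)) - (evalBool f (flipBit j z) - evalBool f (flipBit i (flipBit j z))) =
    (evalBool f z - evalBool f (flipBit j z)) - (evalBool f (flipBit i z) - evalBool f (flipBit j (flipBit i z))) := by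
  rw [flipBit_comm i j z]; ring

/-- **For a gradient family, the aggregate influence of coordinate `j` equals the total influence of member `j`.**
If `g_i = c·(f − f∘flip_i)` on the cube for all `i`, then `Σ_i E[(g_i − g_i^{⊕j})²] = Σ_i Inf_i[g_j]`.
[cite: ODonnellZhao2016, eqn. (2.1)] -/
theorem gradient_coordinate_eq_member (f : MvPolynomial (Fin N) ℝ) (c : ℝ) (g : Fin N → MvPolynomial (Fin N) ℝ)
    (hg : ∀ i z, evalBool (g i) z = c * (evalBool f z - evalBool f (flipBit i z))) (j : Fin N) :
    ∑ i, boolAvg (fun z => (evalBool (g i) z - evalBool (g i) (flipBit j z)) ^ 2) = ∑ i, influence i (g j) := by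
  refine Finset.sum_congr rfl fun i _ => ?_
  unfold influence
  congr 1
  funext z
  rw [hg i z, hg i (flipBit j z), hg j z, hg j (flipBit i z), ← mul_sub, ← mul_sub, gradient_swap f i j z]

/-- **`(B)_j ≤ 4d·(A)_j` on gradient families**: for `g_i = c·(f − f∘flip_i)` with every `g_i` of degree `≤ d`,
`Σ_i E[(g_i − g_i^{⊕j})²] ≤ 4d·E[g_j²]`. [cite: ODonnellZhao2016, eqn. (2.1)] [cite: ODonnell2014, §2.3] -/
theorem gradient_coordinate_le_member {d : ℕ} (f : MvPolynomial (Fin N) ℝ) (c : ℝ)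
    (g : Fin N → MvPolynomial (Fin N) ℝ) (hdeg : ∀ i, (g i).totalDegree ≤ d)
    (hg : ∀ i z, evalBool (g i) z = c * (evalBool f z - evalBool f (flipBit i z))) (j : Fin N) :
    ∑ i, boolAvg (fun z => (evalBool (g i) z - evalBool (g i) (flipBit j z)) ^ 2) ≤
      4 * (d : ℝ) * boolAvg (fun z => evalBool (g j) z ^ 2) := by
  rw [gradient_coordinate_eq_member f c g hg j]
  exact sum_influence_le_degree_mul (g j) (hdeg j)

/-- **On full gradient families the dichotomy collapses to alternative (A).**  If a gradient family of degree `≤ d`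
(`d ≥ 1`) satisfies `(∃ i, θ ≤ E[g_i²]) ∨ (∃ j, θ ≤ Σ_i E[(g_i − g_i^{⊕j})²])`, then `∃ i, θ/(4d) ≤ E[g_i²]` — so for
the families O'Donnell–Zhao's decoupling actually produces, `stub_l1Family` says precisely "`f` has an influential
variable"; alternative (B) earns its keep only on NON-gradient (sub-)families such as the table half of the address
function's gradient. [cite: ODonnellZhao2016, Def. 1.1 and eqn. (2.1)] -/
theorem gradientFamily_memberOnly_of_dichotomy {d : ℕ} (hd : 1 ≤ d) (f : MvPolynomial (Fin N) ℝ) (c : ℝ)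
    (g : Fin N → MvPolynomial (Fin N) ℝ) (hdeg : ∀ i, (g i).totalDegree ≤ d)
    (hg : ∀ i z, evalBool (g i) z = c * (evalBool f z - evalBool f (flipBit i z))) {θ : ℝ} (hθ : 0 ≤ θ)
    (h : (∃ i, θ ≤ boolAvg (fun z => evalBool (g i) z ^ 2)) ∨
      (∃ j, θ ≤ ∑ i, boolAvg (fun z => (evalBool (g i) z - evalBool (g i) (flipBit j z)) ^ 2))) :
    ∃ i, θ / (4 * (d : ℝ)) ≤ boolAvg (fun z => evalBool (g i) z ^ 2) := by
  have hd0 : (0 : ℝ) < (d : ℝ) := by exact_mod_cast hd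
  have hd4 : (0 : ℝ) < 4 * (d : ℝ) := by positivity
  rcases h with ⟨i, hi⟩ | ⟨j, hj⟩
  · refine ⟨i, le_trans ?_ hi⟩
    rw [div_le_iff₀ hd4]
    have hd1 : (1 : ℝ) ≤ (d : ℝ) := by exact_mod_cast hd
    nlinarith
  · refine ⟨j, ?_⟩
    have h2 := hj.trans (gradient_coordinate_le_member f c g hdeg hg j)
    rw [div_le_iff₀ hd4]
    linarith

end Summit.QuantumAdvantage.QuantumAdvantage.Cruxes.DecoupledCoreAA.L1Family.Gradient

end
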